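import Literature.Geometry.Riemannian.ExpMapGaussLemma
import Literature.Geometry.Riemannian.ExponentialMapProofs
import HarnessLib

/-!
# Normal balls: geodesics are locally minimizing (Lee 2018, Prop. 6.11, Cor. 6.12–6.13)

Layer 3d of the proof programme for `Literature.Geometry.Riemannian.lee_expMap_injectivityDomain`
(Lee 2018, Thm. 10.34). From the Gauss lemma (`ExpMapGaussLemma.lean`) and the local diffeomorphism
property of `exp_p` at `0` (`ExpMapLocalDiffeo.lean`) we derive, for a smooth Riemannian
metric on a Hausdorff manifold without boundary:

* `sq_val_le_mul_val_mfderiv_expMap` — **radial Cauchy–Schwarz**: for `u ∈ 𝓔_p`, `η ∈ T_pM`,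
  `g_p(η, u)² ≤ g_p(u, u) · |d(exp_p)_u(η)|²` (the Gauss lemma applied to the radial and the
  `g_p`-orthogonal component of `η`; Lee, Cor. 6.10–6.11: `|∇r| = 1`);
* `ofReal_sub_le_length_of_mapsTo` — **radial length inequality** (the computation in the proof
  of Lee, Prop. 6.11 / Thm. 6.4 alternative proof: along a `C¹` curve `σ` inside a normal
  neighbourhood, `(d/dt) r(σ(t)) ≤ |σ'(t)|_g`, hence `r(σ(b)) - r(σ(a)) ≤ L(σ)`), for the
  smoothed radial function `√(|Log σ|² + θ²)`;
* `exists_normalBall` — existence of a **normal ball**: `ε > 0` with the closed `g_p`-ball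
  `B̄_ε(0) ⊆ 𝓔_p ∩` (domain of normal coordinates `Log`), such that for `|u|_{g_p} < ε`,
  `d(p, exp_p u) = |u|_{g_p}` (**Lee, Prop. 6.11 / Cor. 6.12**: "within any geodesic ball
  around `p`, the radial distance function `r` … satisfies `r(q) = d_g(p, q)`"), the radial
  geodesic `γ_u|[0,1]` is minimizing and `u ∈ ID(p)`; and every `q` with `d(p, q) < ε` is
  `exp_p u` for a unique... for some `u` with `|u|_{g_p} < ε` (**Cor. 6.13**: geodesic balls are
  metric balls).

No definitions, no named facts (D-0026).

## References

* J. M. Lee, *Introduction to Riemannian Manifolds*, 2nd ed. (2018), Thm. 6.9, Cor. 6.10–6.13,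
  Prop. 6.11. [LeeRiemannianManifolds2018]
* S. Gouëzel, Mathlib `Mathlib/Geometry/Manifold/Riemannian/Basic.lean`
  (`setOf_riemannianEDist_lt_subset_nhds`, the real-induction pattern reused here).
-/

noncomputable section

open Bundle Set Filter Function Metric MeasureTheory Manifold
open scoped Manifold ContDiff Topology ENNReal NNReal

namespace Literature.Geometry.Riemannian

open Literature.Geometry.Lorentzian
open Literature.Geometry.Lorentzian.PseudoRiemannianMetric

variable {E : Type*} [NormedAddCommGroup E] [NormedSpace ℝ E] {H : Type*} [TopologicalSpace H]
  {I : ModelWithCorners ℝ E H} {M : Type*} [TopologicalSpace M] [ChartedSpace H M]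
  [IsManifold I ∞ M] {n : ℕ∞ω} [FiniteDimensional ℝ E] [CompleteSpace E] [T2Space M]
  [BoundarylessManifold I M]
  (g : PseudoRiemannianMetric I n E (TangentSpace I : M → Type _)) [g.HasLeviCivita]
  [CovariantDerivative.ContMDiffCovariantDerivative g.leviCivita 1]

/-! ### Radial Cauchy–Schwarz -/

omit [IsManifold I ∞ M] [FiniteDimensional ℝ E] [CompleteSpace E] [T2Space M]
  [BoundarylessManifold I M] [g.HasLeviCivita]
  [CovariantDerivative.ContMDiffCovariantDerivative g.leviCivita 1] in
/-- **Radial Cauchy–Schwarz, algebraic form.** If `B₁` is a bilinear form with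
`B₁(u,u) > 0`, `B₂` a symmetric positive semidefinite one, and `L` a linear map with
`B₂(Lw, Lu) = B₁(w, u)` for all `w` (the Gauss lemma), then `B₁(η,u)² ≤ B₁(u,u) B₂(Lη, Lη)`:
write `η = αu + η'` with `B₁(η', u) = 0`, so that `B₂(Lη, Lη) = α² B₁(u,u) + B₂(Lη', Lη')`.
[folklore] -/
theorem sq_le_mul_of_gaussLemma (B₁ B₂ : E →L[ℝ] E →L[ℝ] ℝ) (L : E →L[ℝ] E) (u η : E)
    (h₂ : ∀ x y : E, B₂ x y = B₂ y x)
    (hpos : 0 < B₁ u u) (hnn : ∀ x : E, 0 ≤ B₂ x x) (hG : ∀ w : E, B₂ (L w) (L u) = B₁ w u) :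
    (B₁ η u) ^ 2 ≤ B₁ u u * B₂ (L η) (L η) := by
  set α : ℝ := B₁ η u / B₁ u u with hα
  set η' : E := η - α • u with hη'
  have horth : B₁ η' u = 0 := by
    simp only [hη', map_sub, map_smul, sub_apply, smul_apply, smul_eq_mul]
    rw [hα]
    field_simp
    ring
  have hdec : L η = α • L u + L η' := by
    simp only [hη', map_sub, map_smul]
    abel
  have hexp : B₂ (L η) (L η) = α * α * B₁ u u + B₂ (L η') (L η') := by
    rw [hdec]
    simp only [map_add, map_smul, add_apply, smul_apply, smul_eq_mul]
    rw [hG u, hG η', h₂ (L u) (L η'), hG η', horth]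
    ring
  rw [hexp]
  have hαu : α * B₁ u u = B₁ η u := by
    rw [hα]
    field_simp
  have hsq : (B₁ η u) ^ 2 = α * α * B₁ u u * B₁ u u := by
    rw [← hαu]
    ring
  rw [hsq]
  have h := mul_nonneg hpos.le (hnn (L η'))
  nlinarith [h]

/-- **Radial Cauchy–Schwarz** (Lee 2018, Cor. 6.10–6.11 in differential form: `|dr(ξ)| ≤ |ξ|_g`,
`∇r = ∂_r` being a unit vector): for a smooth Riemannian metric, `u ∈ 𝓔_p` and `η ∈ T_pM`,
`g_p(η, u)² ≤ g_p(u, u) · g_{exp_p u}(d(exp_p)_u η, d(exp_p)_u η)` (`sq_le_mul_of_gaussLemma` with the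
Gauss lemma `gaussLemma`). [cite: LeeRiemannianManifolds2018, Cor. 6.10 and Thm. 6.9] -/
theorem sq_val_le_mul_val_mfderiv_expMap (hn : (∞ : ℕ∞ω) ≤ n) (hg : g.IsRiemannian) (p : M)
    {u : TangentSpace I p} (hu : u ∈ expDomain g.leviCivita p) (η : TangentSpace I p) :
    (g.val p η u) ^ 2 ≤ g.val p u u *
      g.val (expMap g.leviCivita p u)
        (mfderiv 𝓘(ℝ, E) I (fun w : E ↦ expMap g.leviCivita p (show TangentSpace I p from w))
          (show E from u) (show E from η))
        (mfderiv 𝓘(ℝ, E) I (fun w : E ↦ expMap g.leviCivita p (show TangentSpace I p from w))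
          (show E from u) (show E from η)) := by
  by_cases hu0 : u = 0
  · subst hu0
    simp
  have hnn : ∀ x : TangentSpace I (expMap g.leviCivita p u), 0 ≤ g.val _ x x := fun x ↦ by
    by_cases hx : x = 0
    · rw [hx]; simp
    · exact (hg _ x hx).le
  exact sq_le_mul_of_gaussLemma (E := E) (g.val p) (g.val (expMap g.leviCivita p u))
    (mfderiv 𝓘(ℝ, E) I (fun w : E ↦ expMap g.leviCivita p (show TangentSpace I p from w))
      (show E from u)) u η (g.symm (expMap g.leviCivita p u)) (hg p u hu0) hnn
    (fun w ↦ gaussLemma g hn p hu w)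

/-! ### Images of the domain of normal coordinates -/

omit [IsManifold I ∞ M] [FiniteDimensional ℝ E] [CompleteSpace E] [T2Space M]
  [BoundarylessManifold I M] [g.HasLeviCivita]
  [CovariantDerivative.ContMDiffCovariantDerivative g.leviCivita 1] in
/-- For a local diffeomorphism `f` at `x`, `f` maps the target of the local inverse into its
source (bookkeeping for Mathlib's `IsLocalDiffeomorphAt.localInverse`). [folklore] -/
theorem _root_.IsLocalDiffeomorphAt.map_localInverse_target {F : Type*} [NormedAddCommGroup F]
    [NormedSpace ℝ F] {k : ℕ∞ω} {f : F → M} {a : F}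
    (hf : IsLocalDiffeomorphAt 𝓘(ℝ, F) I k f a) {a' : F} (ha' : a' ∈ hf.localInverse.target) :
    f a' ∈ hf.localInverse.source := by
  have h1 : f a' = (Classical.choose hf) a' := hf.choose_spec.2 ha'
  rw [h1]
  exact (Classical.choose hf).map_source ha'

/-! ### The radial length inequality -/

/-- **Radial length inequality** (the computation in Lee 2018, proof of Prop. 6.11 and Cor. 6.10:
along a `C¹` curve inside a normal neighbourhood `(d/dt) r(σ(t)) ≤ |σ'(t)|_g`, so that
`r(σ(b)) - r(σ(a)) ≤ L(σ|[a,b])`), for the smoothed radial function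
`ρ_θ = √(g_p(Log σ, Log σ) + θ²)`, `θ > 0` (which is `C¹` also where `σ` passes through `p`):
if `σ` is `C¹` on `[a, b]` with values in the domain of the local inverse `Log` of `exp_p` and
`Log ∘ σ` takes values in `𝓔_p`, then `ρ_θ(b) - ρ_θ(a) ≤ L(σ|[a,b])`. Proof: `Log ∘ σ = c` is
`C¹`, `σ = exp_p ∘ c`, `σ' = d(exp_p)_c(c')`, and `|ρ_θ'| = |g_p(c', c)|/ρ_θ ≤ |σ'|_g` by radial
Cauchy–Schwarz; then integrate (`enorm_sub_le_lintegral_deriv_of_contDiffOn_Icc`).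
[cite: LeeRiemannianManifolds2018, Prop. 6.11 (proof)] -/
theorem ofReal_sub_le_length_of_mapsTo (hn : (∞ : ℕ∞ω) ≤ n) (hg : g.IsRiemannian) (p : M)
    (hf : IsLocalDiffeomorphAt 𝓘(ℝ, E) I ∞
      (fun w : E ↦ expMap g.leviCivita p (show TangentSpace I p from w)) 0)
    {σ : ℝ → M} {a b : ℝ} (hab : a ≤ b) (hσ : ContMDiffOn 𝓘(ℝ, ℝ) I 1 σ (Icc a b))
    (hsrc : MapsTo σ (Icc a b) hf.localInverse.source)
    (h𝓔 : ∀ t ∈ Icc a b, (show TangentSpace I p from hf.localInverse (σ t)) ∈ expDomain g.leviCivita p)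
    {θ : ℝ} (hθ : 0 < θ) :
    ENNReal.ofReal (Real.sqrt (g.val p (show TangentSpace I p from hf.localInverse (σ b))
        (show TangentSpace I p from hf.localInverse (σ b)) + θ ^ 2) -
      Real.sqrt (g.val p (show TangentSpace I p from hf.localInverse (σ a))
        (show TangentSpace I p from hf.localInverse (σ a)) + θ ^ 2)) ≤ g.length hg σ a b := by
  haveI : Fact (1 ≤ n) := ⟨le_trans (by exact_mod_cast le_top) hn⟩
  haveI := contMDiffCovariantDerivative_leviCivita_infty g hn
  set cov := g.leviCivita with hcov
  set ex : E → M := fun w ↦ expMap cov p (show TangentSpace I p from w) with hex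
  set Log := hf.localInverse with hLog
  set 𝓔 : Set E := {u : E | (show TangentSpace I p from u) ∈ expDomain cov p} with h𝓔def
  have h𝓔o : IsOpen 𝓔 := isOpen_expDomain (cov := cov) (k := (⊤ : ℕ∞)) le_top p
  have hexs : ContMDiffOn 𝓘(ℝ, E) I ((⊤ : ℕ∞) : ℕ∞ω) ex 𝓔 :=
    contMDiffOn_expMap (cov := cov) (k := (⊤ : ℕ∞)) le_top p
  -- the bilinear form at `p`, as a map on `E`
  set B : E →L[ℝ] E →L[ℝ] ℝ := g.val p with hB
  -- the lift `c = Log ∘ σ`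
  set c : ℝ → E := fun t ↦ Log (σ t) with hc
  have hcs : ContMDiffOn 𝓘(ℝ, ℝ) 𝓘(ℝ, E) 1 c (Icc a b) :=
    ((hf.localInverse_contMDiffOn.of_le (by exact_mod_cast le_top)).comp hσ hsrc)
  have hcd : ContDiffOn ℝ 1 c (Icc a b) := contMDiffOn_iff_contDiffOn.1 hcs
  -- `σ = ex ∘ c` on `[a, b]`
  have hσc : ∀ t ∈ Icc a b, σ t = ex (c t) := fun t ht ↦
    (hf.localInverse_right_inv (hsrc ht)).symm
  -- the smoothed radial function
  set N : ℝ → ℝ := fun t ↦ B (c t) (c t) + θ ^ 2 with hN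
  have hNd : ContDiffOn ℝ 1 N (Icc a b) := by
    have h1 : ContDiffOn ℝ 1 (fun t ↦ B (c t)) (Icc a b) := B.contDiff.comp_contDiffOn hcd
    exact (h1.clm_apply hcd).add contDiffOn_const
  have hNpos : ∀ t ∈ Icc a b, 0 < N t := by
    intro t _
    have h0 : 0 ≤ B (c t) (c t) := by
      by_cases hct : c t = 0
      · rw [hct]; simp
      · exact (hg p (c t) hct).le
    show 0 < B (c t) (c t) + θ ^ 2
    positivity
  set ρ : ℝ → ℝ := fun t ↦ Real.sqrt (N t) with hρ
  have hρd : ContDiffOn ℝ 1 ρ (Icc a b) := hNd.sqrt fun t ht ↦ (hNpos t ht).ne'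
  -- derivative bound at interior points
  have hbound : ∀ t ∈ Ioo a b, |deriv ρ t| ≤
      Real.sqrt (g.val (σ t) (mfderiv 𝓘(ℝ, ℝ) I σ t 1) (mfderiv 𝓘(ℝ, ℝ) I σ t 1)) := by
    intro t ht
    have htI : t ∈ Icc a b := Ioo_subset_Icc_self ht
    have hnhds : Icc a b ∈ 𝓝 t := Icc_mem_nhds ht.1 ht.2
    -- derivatives of `c`, `N`, `ρ` at `t`
    have hcda : DifferentiableAt ℝ c t := (hcd.differentiableOn one_ne_zero t htI).differentiableAt hnhds
    have hcder : HasDerivAt c (deriv c t) t := hcda.hasDerivAt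
    have hNder : HasDerivAt N (B (c t) (deriv c t) + B (deriv c t) (c t)) t := by
      have h1 : HasDerivAt (fun t ↦ B (c t) (c t)) (B (c t) (deriv c t) + B (deriv c t) (c t)) t :=
        B.hasDerivAt_of_bilinear (fun _ ↦ hcder) (fun _ ↦ hcder)
      exact h1.add_const (θ ^ 2)
    have hNt : 0 < N t := hNpos t htI
    have hρder : HasDerivAt ρ ((B (c t) (deriv c t) + B (deriv c t) (c t)) / (2 * Real.sqrt (N t))) t :=
      hNder.sqrt hNt.ne'
    rw [hρder.deriv]
    -- `σ' = d ex (c')`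
    have hexd : MDifferentiableAt 𝓘(ℝ, E) I ex (c t) :=
      (hexs.contMDiffAt (h𝓔o.mem_nhds (h𝓔 t htI))).mdifferentiableAt (by simp)
    have hcm : HasMFDerivAt 𝓘(ℝ, ℝ) 𝓘(ℝ, E) c t (ContinuousLinearMap.toSpanSingleton ℝ (deriv c t)) :=
      hasMFDerivAt_iff_hasFDerivAt.2 hcder.hasFDerivAt
    have hcomp := hexd.hasMFDerivAt.comp t hcm
    have hσeq : σ =ᶠ[𝓝 t] (ex ∘ c) := by
      filter_upwards [Ioo_mem_nhds ht.1 ht.2] with t' ht'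
      exact hσc t' (Ioo_subset_Icc_self ht')
    have hσ' : mfderiv 𝓘(ℝ, ℝ) I σ t 1 = mfderiv 𝓘(ℝ, E) I ex (c t) (deriv c t) := by
      rw [hσeq.mfderiv_eq, hcomp.mfderiv]
      have h2 : (ContinuousLinearMap.toSpanSingleton ℝ (deriv c t)) (1 : ℝ) = deriv c t := by simp
      exact congrArg (mfderiv 𝓘(ℝ, E) I ex (c t)) h2
    -- radial Cauchy–Schwarz at `u = c t`, `η = c' t`, at the base point `ex (c t) = σ t`
    have hpt : expMap cov p (show TangentSpace I p from c t) = σ t := (hσc t htI).symm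
    set S : ℝ := g.val (σ t) (mfderiv 𝓘(ℝ, ℝ) I σ t 1) (mfderiv 𝓘(ℝ, ℝ) I σ t 1) with hS
    have hS0 : 0 ≤ S := by
      by_cases h0 : mfderiv 𝓘(ℝ, ℝ) I σ t 1 = 0
      · rw [hS, h0]; simp
      · exact (hg _ _ h0).le
    have hCS' : (B (deriv c t) (c t)) ^ 2 ≤ B (c t) (c t) * S := by
      have h := sq_val_le_mul_val_mfderiv_expMap g hn hg p (h𝓔 t htI)
        (show TangentSpace I p from deriv c t)
      rw [hpt] at h
      rw [hS, hσ']
      exact h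
    -- the estimate `|N'| / (2 √N) ≤ √S`
    have hsym : B (c t) (deriv c t) = B (deriv c t) (c t) := g.symm p _ _
    rw [hsym, ← two_mul, mul_div_mul_left _ _ (two_ne_zero), abs_div,
      abs_of_pos (Real.sqrt_pos.2 hNt), div_le_iff₀ (Real.sqrt_pos.2 hNt)]
    have hG0 : 0 ≤ B (c t) (c t) := by
      by_cases hct : c t = 0
      · rw [hct]; simp
      · exact (hg p (c t) hct).le
    have h1 : |B (deriv c t) (c t)| ≤ Real.sqrt (B (c t) (c t)) * Real.sqrt S := by
      rw [← Real.sqrt_mul hG0, ← Real.sqrt_sq_eq_abs]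
      exact Real.sqrt_le_sqrt hCS'
    have h2 : Real.sqrt (B (c t) (c t)) ≤ Real.sqrt (N t) :=
      Real.sqrt_le_sqrt (by show B (c t) (c t) ≤ B (c t) (c t) + θ ^ 2; nlinarith)
    calc |B (deriv c t) (c t)| ≤ Real.sqrt (B (c t) (c t)) * Real.sqrt S := h1
      _ ≤ Real.sqrt (N t) * Real.sqrt S := by gcongr
      _ = Real.sqrt S * Real.sqrt (N t) := mul_comm _ _
  -- integrate
  have hFTC := enorm_sub_le_lintegral_deriv_of_contDiffOn_Icc hρd hab
  have hlhs : ENNReal.ofReal (ρ b - ρ a) ≤ ‖ρ b - ρ a‖ₑ := by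
    rw [Real.enorm_eq_ofReal_abs]
    exact ENNReal.ofReal_le_ofReal (le_abs_self _)
  refine hlhs.trans (hFTC.trans ?_)
  rw [g.length_eq_lintegral hg, ← restrict_Ioo_eq_restrict_Icc]
  refine setLIntegral_mono' measurableSet_Ioo fun t ht ↦ ?_
  rw [Real.enorm_eq_ofReal_abs]
  exact ENNReal.ofReal_le_ofReal (hbound t ht)

/-! ### Normal balls -/

/-- **Normal balls: geodesics are locally minimizing and geodesic balls are metric balls**
(Lee 2018, Prop. 6.11, Cor. 6.12, Cor. 6.13; O'Neill 1983, Ch. 5, Prop. 16 / Cor. 17). For a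
smooth Riemannian metric on a Hausdorff manifold without boundary and `p ∈ M` there is `ε > 0`
such that, with `|u| = g_p(u,u)^{1/2}` and `exp_p = expMap g.leviCivita p`:
(1) every `u` with `|u| < ε` lies in `𝓔_p` and `d(p, exp_p u) = |u|`;
(2) every point `q` with `d(p, q) < ε` is `exp_p u` for some `u` with `|u| < ε`.
Proof (Lee pp. 161–163 through the Gauss lemma): `d ≤ |u|` by the radial geodesic; for `≥` and
(2), a `C¹` path from `p` of length `< ε` never leaves the closed geodesic ball (real induction,
`IsClosed.Icc_subset_of_forall_mem_nhdsGT_of_Icc_subset`, the radial length inequality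
`ofReal_sub_le_length_of_mapsTo` bounding the radius of its endpoint by its length).
[cite: LeeRiemannianManifolds2018, Prop. 6.11 and Cor. 6.12–6.13] -/
theorem exists_normalBall (hn : (∞ : ℕ∞ω) ≤ n) (hg : g.IsRiemannian) (p : M) :
    ∃ ε > (0 : ℝ),
      (∀ u : TangentSpace I p, g.val p u u < ε ^ 2 →
        u ∈ expDomain g.leviCivita p ∧
          g.edist hg p (expMap g.leviCivita p u) = ENNReal.ofReal (Real.sqrt (g.val p u u))) ∧
      (∀ q : M, g.edist hg p q < ENNReal.ofReal ε →
        ∃ u : TangentSpace I p, g.val p u u < ε ^ 2 ∧ expMap g.leviCivita p u = q) := by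
  haveI : Fact (1 ≤ n) := ⟨le_trans (by exact_mod_cast le_top) hn⟩
  haveI := contMDiffCovariantDerivative_leviCivita_infty g hn
  set cov := g.leviCivita with hcov
  set ex : E → M := fun w ↦ expMap cov p (show TangentSpace I p from w) with hex
  set 𝓔 : Set E := {u : E | (show TangentSpace I p from u) ∈ expDomain cov p} with h𝓔def
  have h𝓔o : IsOpen 𝓔 := isOpen_expDomain (cov := cov) (k := (⊤ : ℕ∞)) le_top p
  have h0𝓔 : (0 : E) ∈ 𝓔 := zero_mem_expDomain (cov := cov) p
  have hexs : ContMDiffOn 𝓘(ℝ, E) I ((⊤ : ℕ∞) : ℕ∞ω) ex 𝓔 :=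
    contMDiffOn_expMap (cov := cov) (k := (⊤ : ℕ∞)) le_top p
  have hex0 : ex 0 = p := expMap_zero (cov := cov) p
  -- normal coordinates
  have hf : IsLocalDiffeomorphAt 𝓘(ℝ, E) I ((⊤ : ℕ∞) : ℕ∞ω) ex 0 :=
    isLocalDiffeomorphAt_expMap_zero_of_le (cov := cov) (k := (⊤ : ℕ∞)) le_top p
  set Log := hf.localInverse with hLog
  have hLog0 : Log p = 0 := by
    have h := hf.localInverse_left_inv hf.localInverse_mem_target
    rwa [hex0] at h
  have hpsrc : p ∈ Log.source := by
    have h := hf.localInverse_mem_source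
    rwa [hex0] at h
  -- a closed Euclidean ball inside `Log.target ∩ 𝓔`
  obtain ⟨R, hR, hRball⟩ : ∃ R > 0, closedBall (0 : E) R ⊆ Log.target ∩ 𝓔 := by
    have h : Log.target ∩ 𝓔 ∈ 𝓝 (0 : E) :=
      inter_mem (Log.open_target.mem_nhds hf.localInverse_mem_target) (h𝓔o.mem_nhds h0𝓔)
    obtain ⟨R, hR, hRb⟩ := Metric.mem_nhds_iff.1 h
    exact ⟨R / 2, by positivity, (closedBall_subset_ball (by linarith)).trans hRb⟩
  -- comparison of `g_p` with the norm
  set B : E →L[ℝ] E →L[ℝ] ℝ := g.val p with hB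
  obtain ⟨c₀, hc₀, hc₀v⟩ := exists_pos_mul_norm_sq_le_of_pos_def B (fun v hv ↦ hg p v hv)
  -- the radius
  set ε : ℝ := R * Real.sqrt c₀ with hεdef
  have hε : 0 < ε := mul_pos hR (Real.sqrt_pos.2 hc₀)
  have hεsq : ε ^ 2 = R ^ 2 * c₀ := by rw [hεdef, mul_pow, Real.sq_sqrt hc₀.le]
  -- the closed `g_p`-ball `Bg` lies in the Euclidean ball
  set Bg : Set E := {w : E | B w w ≤ ε ^ 2} with hBg
  have hBgR : Bg ⊆ closedBall (0 : E) R := by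
    intro w hw
    rw [mem_closedBall, dist_zero_right]
    have h1 : c₀ * ‖w‖ ^ 2 ≤ R ^ 2 * c₀ := ((hc₀v w).trans hw).trans_eq hεsq
    have h2 : ‖w‖ ^ 2 ≤ R ^ 2 := by nlinarith
    exact (pow_le_pow_iff_left₀ (norm_nonneg w) hR.le two_ne_zero).1 h2
  have hBgT : Bg ⊆ Log.target := fun w hw ↦ (hRball (hBgR hw)).1
  have hBg𝓔 : Bg ⊆ 𝓔 := fun w hw ↦ (hRball (hBgR hw)).2
  have hBcont : Continuous fun w : E ↦ B w w := B.continuous₂.comp (continuous_id.prodMk continuous_id)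
  have hBgc : IsCompact Bg :=
    Metric.isCompact_of_isClosed_isBounded (isClosed_le hBcont continuous_const)
      (isBounded_closedBall.subset hBgR)
  have hBnn : ∀ w : E, 0 ≤ B w w := fun w ↦ by
    by_cases hw : w = 0
    · rw [hw]; simp
    · exact (hg p w hw).le
  -- its image `W` (closed), inside the domain of `Log`, and the open geodesic ball `V ⊆ W`
  set W : Set M := ex '' Bg with hW
  have hWc : IsCompact W := hBgc.image_of_continuousOn (hexs.continuousOn.mono hBg𝓔)
  have hWcl : IsClosed W := hWc.isClosed
  have hWsrc : W ⊆ Log.source := by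
    rintro _ ⟨w, hw, rfl⟩
    exact hf.map_localInverse_target (hBgT hw)
  have hLogW : ∀ y ∈ W, Log y ∈ Bg ∧ ex (Log y) = y := by
    rintro _ ⟨w, hw, rfl⟩
    have h : Log (ex w) = w := hf.localInverse_left_inv (hBgT hw)
    refine ⟨by rw [h]; exact hw, by rw [h]⟩
  set V : Set M := Log.source ∩ (fun y ↦ B (Log y) (Log y)) ⁻¹' Iio (ε ^ 2) with hV
  have hVo : IsOpen V :=
    (hBcont.comp_continuousOn hf.localInverse_contMDiffOn.continuousOn).isOpen_inter_preimage
      Log.open_source isOpen_Iio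
  have hVW : V ⊆ W := by
    rintro y ⟨hy, hy'⟩
    have hy'' : B (Log y) (Log y) < ε ^ 2 := hy'
    exact ⟨Log y, le_of_lt hy'', hf.localInverse_right_inv hy⟩
  have hpV : p ∈ V := by
    refine ⟨hpsrc, ?_⟩
    show B (Log p) (Log p) < ε ^ 2
    rw [hLog0]
    simpa using pow_pos hε 2
  -- monotonicity of length in the endpoint
  have hmono : ∀ (γ : ℝ → M) {t : ℝ}, t ≤ 1 → g.length hg γ 0 t ≤ g.length hg γ 0 1 := by
    intro γ t ht
    letI := g.riemannianBundle hg
    exact pathELength_mono le_rfl ht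
  -- KEY: a `C¹` path from `p` of length `< ε` stays in `W`, and the radius of its points is
  -- bounded by its length
  have key : ∀ γ : ℝ → M, ContMDiff 𝓘(ℝ, ℝ) I 1 γ → γ 0 = p →
      g.length hg γ 0 1 < ENNReal.ofReal ε →
      ∀ t ∈ Icc (0 : ℝ) 1, γ t ∈ W ∧
        ENNReal.ofReal (Real.sqrt (B (Log (γ t)) (Log (γ t)))) ≤ g.length hg γ 0 t := by
    intro γ hγ hγ0 hγL
    -- radius bound for initial sub-paths inside `W`
    have hrad : ∀ t ∈ Icc (0 : ℝ) 1, (∀ s ∈ Icc 0 t, γ s ∈ W) →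
        ENNReal.ofReal (Real.sqrt (B (Log (γ t)) (Log (γ t)))) ≤ g.length hg γ 0 t := by
      intro t ht hW'
      have hsrc' : MapsTo γ (Icc 0 t) Log.source := fun s hs ↦ hWsrc (hW' s hs)
      have h𝓔' : ∀ s ∈ Icc 0 t,
          (show TangentSpace I p from Log (γ s)) ∈ expDomain cov p :=
        fun s hs ↦ hBg𝓔 (hLogW _ (hW' s hs)).1
      have hθ : ∀ θ : ℝ, 0 < θ →
          ENNReal.ofReal (Real.sqrt (B (Log (γ t)) (Log (γ t)) + θ ^ 2) - θ) ≤
            g.length hg γ 0 t := by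
        intro θ hθ
        have h := ofReal_sub_le_length_of_mapsTo g hn hg p hf ht.1 hγ.contMDiffOn hsrc' h𝓔' hθ
        have h0 : Real.sqrt (B (Log (γ 0)) (Log (γ 0)) + θ ^ 2) = θ := by
          rw [hγ0, hLog0]
          simp [Real.sqrt_sq hθ.le]
        have h0' : Real.sqrt (g.val p (show TangentSpace I p from Log (γ 0))
            (show TangentSpace I p from Log (γ 0)) + θ ^ 2) = θ := h0
        rw [h0'] at h
        exact h
      have hlim : Tendsto (fun θ : ℝ ↦
          ENNReal.ofReal (Real.sqrt (B (Log (γ t)) (Log (γ t)) + θ ^ 2) - θ)) (𝓝[>] 0)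
          (𝓝 (ENNReal.ofReal (Real.sqrt (B (Log (γ t)) (Log (γ t)))))) := by
        refine ENNReal.tendsto_ofReal (Tendsto.mono_left ?_ nhdsWithin_le_nhds)
        have hc : Continuous fun θ : ℝ ↦
            Real.sqrt (B (Log (γ t)) (Log (γ t)) + θ ^ 2) - θ :=
          ((continuous_const.add (continuous_pow 2)).sqrt).sub continuous_id
        have h := hc.tendsto 0
        simpa using h
      exact le_of_tendsto hlim (eventually_mem_nhdsWithin.mono fun θ hθ' ↦ hθ θ hθ')
    -- real induction: `γ` never leaves `W`
    set A : Set ℝ := {t | γ t ∈ W} with hA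
    have hAcl : IsClosed (A ∩ Icc 0 1) := (hWcl.preimage hγ.continuous).inter isClosed_Icc
    have h0A : (0 : ℝ) ∈ A := by
      show γ 0 ∈ W
      rw [hγ0]
      exact hVW hpV
    have hAll : Icc (0 : ℝ) 1 ⊆ A := by
      refine hAcl.Icc_subset_of_forall_mem_nhdsGT_of_Icc_subset h0A fun t₁ ht₁ ht₁A ↦ ?_
      have hW' : ∀ s ∈ Icc 0 t₁, γ s ∈ W := fun s hs ↦ ht₁A hs
      have hr := hrad t₁ ⟨ht₁.1, ht₁.2.le⟩ hW'
      have hlt : ENNReal.ofReal (Real.sqrt (B (Log (γ t₁)) (Log (γ t₁)))) < ENNReal.ofReal ε :=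
        lt_of_le_of_lt (hr.trans (hmono γ ht₁.2.le)) hγL
      have hV' : γ t₁ ∈ V := by
        refine ⟨hWsrc (hW' t₁ ⟨ht₁.1, le_rfl⟩), ?_⟩
        show B (Log (γ t₁)) (Log (γ t₁)) < ε ^ 2
        have h1 : Real.sqrt (B (Log (γ t₁)) (Log (γ t₁))) < ε :=
          (ENNReal.ofReal_lt_ofReal_iff hε).1 hlt
        rwa [Real.sqrt_lt' hε] at h1
      have hev : ∀ᶠ s in 𝓝 t₁, γ s ∈ V :=
        hγ.continuous.continuousAt.preimage_mem_nhds (hVo.mem_nhds hV')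
      exact nhdsWithin_le_nhds (hev.mono fun s hs ↦ hVW hs)
    intro t ht
    exact ⟨hAll ht, hrad t ht fun s hs ↦ hAll ⟨hs.1, hs.2.trans ht.2⟩⟩
  refine ⟨ε, hε, fun u hu ↦ ?_, fun q hq ↦ ?_⟩
  · -- (1) `d(p, exp_p u) = |u|`
    have huBg : (show E from u) ∈ Bg := le_of_lt hu
    have hu𝓔 : u ∈ expDomain cov p := hBg𝓔 huBg
    refine ⟨hu𝓔, le_antisymm ?_ ?_⟩
    · -- `≤`: the radial geodesic has length `|u|`
      obtain ⟨hmax, h0dom, -, -⟩ := maximalGeodesic_spec' (cov := cov) p u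
      have hI : Icc (0 : ℝ) 1 ⊆ maximalGeodesicDomain cov p u := hmax.2.1.out h0dom hu𝓔.2
      have hgeo := isGeodesicOn_expMap_smul (cov := cov) p u
      have hlen := length_eq_of_isGeodesicOn (g := g) hg hmax.isOpen hmax.2.1 hgeo
        (a := 0) (b := 1) hI h0dom
      rw [velocity_expMap_smul_zero (cov := cov) p u] at hlen
      have hpt : expMap cov p ((0 : ℝ) • u) = p := by
        rw [zero_smul]
        exact expMap_zero (cov := cov) p
      rw [hpt, sub_zero, one_mul] at hlen
      have hC1 : ContMDiffOn 𝓘(ℝ, ℝ) I 1 (fun t : ℝ ↦ expMap cov p (t • u)) (Icc 0 1) :=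
        (hgeo.contMDiffOn_one hmax.isOpen).mono hI
      have h := edist_le_length hg zero_le_one hC1
      rw [hlen] at h
      have h1 : expMap cov p ((1 : ℝ) • u) = expMap cov p u := by rw [one_smul]
      rw [hpt, h1] at h
      exact h
    · -- `≥`: a shorter path would contradict `key`
      by_contra hlt
      push Not at hlt
      letI := g.riemannianBundle hg
      obtain ⟨γ, hγ0, hγ1, hγs, hγL, -⟩ :=
        exists_lt_locally_constant_of_riemannianEDist_lt (I := I) hlt zero_lt_one
      have hsq : Real.sqrt (g.val p u u) < ε := by
        rw [Real.sqrt_lt' hε]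
        exact hu
      have hγL1 : g.length hg γ 0 1 < ENNReal.ofReal (Real.sqrt (g.val p u u)) := hγL
      have hγL' : g.length hg γ 0 1 < ENNReal.ofReal ε :=
        lt_trans hγL1 ((ENNReal.ofReal_lt_ofReal_iff hε).2 hsq)
      obtain ⟨-, hkey⟩ := key γ hγs hγ0 hγL' 1 ⟨zero_le_one, le_rfl⟩
      have hLu : Log (γ 1) = (show E from u) := by
        rw [hγ1]
        exact hf.localInverse_left_inv (hBgT huBg)
      rw [hLu] at hkey
      exact absurd (lt_of_le_of_lt hkey hγL1) (lt_irrefl _)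
  · -- (2) points at distance `< ε` are in the geodesic ball
    letI := g.riemannianBundle hg
    obtain ⟨γ, hγ0, hγ1, hγs, hγL, -⟩ :=
      exists_lt_locally_constant_of_riemannianEDist_lt (I := I) hq zero_lt_one
    have hγL' : g.length hg γ 0 1 < ENNReal.ofReal ε := hγL
    obtain ⟨hW1, hkey⟩ := key γ hγs hγ0 hγL' 1 ⟨zero_le_one, le_rfl⟩
    rw [hγ1] at hW1 hkey
    obtain ⟨-, hexq⟩ := hLogW q hW1
    refine ⟨(show TangentSpace I p from Log q), ?_, hexq⟩
    have h1 : ENNReal.ofReal (Real.sqrt (B (Log q) (Log q))) < ENNReal.ofReal ε :=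
      lt_of_le_of_lt hkey hγL'
    have h2 : Real.sqrt (B (Log q) (Log q)) < ε := (ENNReal.ofReal_lt_ofReal_iff hε).1 h1
    rw [Real.sqrt_lt' hε] at h2
    exact h2

/-- **Normal balls, in the form of hypothesis (L1) of
`HopfRinowCompact.exists_isMinimizingUpTo_of_local`** (Lee 2018, Prop. 6.11 / Cor. 6.12–6.13):
every `y` has `δ > 0` such that each `x` with `d(y, x) < δ` is `exp_y v` with `|v|_g = d(y, x)`.
[cite: LeeRiemannianManifolds2018, Prop. 6.11 and Cor. 6.12–6.13] -/
theorem exists_riemannianExpMap_eq_of_edist_lt_of_le (hn : (∞ : ℕ∞ω) ≤ n) (hg : g.IsRiemannian) (y : M) :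
    ∃ δ : ℝ, 0 < δ ∧ ∀ x : M, g.edist hg y x < ENNReal.ofReal δ →
      ∃ v : TangentSpace I y, riemannianExpMap g y v = x ∧
        ENNReal.ofReal (Real.sqrt (g.val y v v)) = g.edist hg y x := by
  obtain ⟨ε, hε, h1, h2⟩ := exists_normalBall g hn hg y
  refine ⟨ε, hε, fun x hx ↦ ?_⟩
  obtain ⟨u, hu, hux⟩ := h2 x hx
  refine ⟨u, hux, ?_⟩
  rw [← hux]
  exact ((h1 u hu).2).symm

end Literature.Geometry.Riemannian
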